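import Summits.AtomisticToContinuum.FouriersLaw.Theorems.PhononMeanFreePathIncoherentChannelLightConeHelper5

/-!
# The weighted-Lebesgue inequality behind the `N`-uniform fourth moment of the bond currents

STATUS (w-FSD, piece FS-D of `stub_lightConeWindow`, stmt-AtomisticToContinuum-9127): (D2b) helper
(light imports: no site reflection, no `OddSectorIrreversibility` closure), registered sub-goal
`pinnedChain_lintegral_majorant_mul_gibbsDensity_le`; consumed by `…ContactCurrentFourthMoment`.

Helper (`--supports`) for the line `contact-current-forgetting` of the crux
`JunctionLocality.NonBallistic` (stmt-AtomisticToContinuum-9127), stub `stub_lightConeWindow` (LC),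
piece FS-D (Gibbs statics with controlled `N`-dependence), input of (D2). For the pinned anharmonic
chain `P = pinnedChain ω₂ lam β γ` (`ω₂ > 0`, `lam, β ≥ 0`), `T > 0`, any two sites `k, k'` of an
`(m+1)`-chain and the majorant `F = (p_k⁴ + p_{k'}⁴)(1 + q_k¹² + q_{k'}¹²)` of `j_k⁴` (`k' = k+1`):

  `(∫⁻ F e^{-H/T}) · (B m₀) ≤ ((B + 2A) · 2 m₄) · ∫⁻ e^{-H/T}`,

`B = ∫ e^{-U/T}`, `A = ∫ a¹² e^{-U/T}`, `m₀ = ∫ e^{-a²/(2T)}`, `m₄ = ∫ a⁴ e^{-a²/(2T)}` — all four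
independent of `N, k, k'`.

* `pinnedChain_lintegral_sep_mul_gibbsDensity` — factorisation `e^{-H/T} = e^{-Φ(q)/T} e^{-∑p²/(2T)}`
  of phase-space lower integrals of `g(q) f(p) e^{-H/T}` (Tonelli);
* `lintegral_coord_mul_kinetic(_mul)` — the one-coordinate marginal of the kinetic weight at ANY
  coordinate `i` is `e^{-a²/(2T)}` times the remaining kinetic integral
  (`MeasureTheory.volume_preserving_piFinSuccAbove`), whence the kinetic Chebyshev identity;
* `pinnedChain_lintegral_conf_majorant_le` — `(∫⁻ (1 + q_k¹² + q_{k'}¹²) e^{-Φ/T}) B ≤ (B + 2A) ∫⁻ e^{-Φ/T}`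
  by the site-uniform Chebyshev step `ChainVariation.lintegral_coord_potential_le` (`h(a) = a¹²`);
* `lintegral_kin_majorant_eq` — `(∫⁻ (p_k⁴ + p_{k'}⁴) κ) m₀ = 2 m₄ ∫⁻ κ`;
* `pinnedChain_lintegral_majorant_mul_gibbsDensity_le` — the displayed inequality.

Everything is elementary and tagged folklore.
-/

noncomputable section

open MeasureTheory Set
open scoped ENNReal

namespace Summit.AtomisticToContinuum.FouriersLaw.Theorems.NonBallistic

open Literature.MathematicalPhysics.KineticTheory.HeatConduction
open Summit.AtomisticToContinuum.FouriersLaw.Theorems.SubdiffusiveBondHeat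
open Summit.AtomisticToContinuum.FouriersLaw.Theorems.PhononMeanFreePath
  (lightCone_radMono_ofReal_pow_even lightCone_lintegral_pow_exp_neg_U_ne_top)
open Summit.AtomisticToContinuum.FouriersLaw.Theorems.ChainVariation (lintegral_coord_potential_le)

variable {ω₂ lam β : ℝ}

/-! ## Factorisation of the Gibbs weight into configurational and kinetic parts -/

/-- `e^{-H/T} = e^{-Φ(q)/T} · e^{-∑p²/(2T)}`. [folklore] -/
theorem gibbsDensity_eq_conf_mul_kinetic (P : OscillatorChain) (N : ℕ) (T : ℝ) (z : PhaseSpace N) :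
    P.gibbsDensity N T z =
      Real.exp (-P.potential N z.1 / T) * Real.exp (-(∑ j, z.2 j ^ 2 / 2) / T) := by
  rw [OscillatorChain.gibbsDensity, P.hamiltonian_eq_kinetic_add_potential, ← Real.exp_add]
  congr 1
  ring

/-- **Tonelli for separated observables.** For measurable `g = g(q)`, `f = f(p)` (`ℝ≥0∞`-valued):
`∫⁻ g(q) f(p) e^{-H/T} = (∫⁻ g e^{-Φ/T} dq) · (∫⁻ f e^{-∑p²/(2T)} dp)`. [folklore] -/
theorem pinnedChain_lintegral_sep_mul_gibbsDensity (ω₂ lam β γ : ℝ) (N : ℕ) (T : ℝ)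
    {g f : (Fin N → ℝ) → ℝ≥0∞} (hg : Measurable g) (hf : Measurable f) :
    ∫⁻ z : PhaseSpace N, g z.1 * f z.2 * ENNReal.ofReal ((pinnedChain ω₂ lam β γ).gibbsDensity N T z) =
      (∫⁻ q : Fin N → ℝ, g q *
          ENNReal.ofReal (Real.exp (-(pinnedChain ω₂ lam β γ).potential N q / T))) *
        ∫⁻ p : Fin N → ℝ, f p * ENNReal.ofReal (Real.exp (-(∑ j, p j ^ 2 / 2) / T)) := by
  set P := pinnedChain ω₂ lam β γ with hP
  have hUc : Continuous P.U := (pinnedChain_contDiff_U ω₂ lam β γ (n := 0)).continuous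
  have hVc : Continuous P.V := (pinnedChain_contDiff_V ω₂ lam β γ (n := 0)).continuous
  have hΦ : Measurable (P.potential N) := (continuous_potential P hUc hVc N).measurable
  have hKc : Continuous fun p : Fin N → ℝ => Real.exp (-(∑ j, p j ^ 2 / 2) / T) := by fun_prop
  have hgm : Measurable fun q : Fin N → ℝ =>
      g q * ENNReal.ofReal (Real.exp (-P.potential N q / T)) :=
    hg.mul (by fun_prop)
  have hfm : Measurable fun p : Fin N → ℝ =>
      f p * ENNReal.ofReal (Real.exp (-(∑ j, p j ^ 2 / 2) / T)) :=
    hf.mul hKc.measurable.ennreal_ofReal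
  rw [← lintegral_prod_mul hgm.aemeasurable hfm.aemeasurable]
  refine lintegral_congr fun z => ?_
  rw [gibbsDensity_eq_conf_mul_kinetic, ENNReal.ofReal_mul (Real.exp_pos _).le]
  ring

/-- The partition function factorises: `∫⁻ e^{-H/T} = (∫⁻ e^{-Φ/T} dq)(∫⁻ e^{-∑p²/(2T)} dp)`.
[folklore] -/
theorem pinnedChain_lintegral_gibbsDensity_eq (ω₂ lam β γ : ℝ) (N : ℕ) (T : ℝ) :
    ∫⁻ z : PhaseSpace N, ENNReal.ofReal ((pinnedChain ω₂ lam β γ).gibbsDensity N T z) =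
      (∫⁻ q : Fin N → ℝ, ENNReal.ofReal (Real.exp (-(pinnedChain ω₂ lam β γ).potential N q / T))) *
        ∫⁻ p : Fin N → ℝ, ENNReal.ofReal (Real.exp (-(∑ j, p j ^ 2 / 2) / T)) := by
  have h := pinnedChain_lintegral_sep_mul_gibbsDensity ω₂ lam β γ N T (g := fun _ => 1)
    (f := fun _ => 1) measurable_const measurable_const
  simpa only [one_mul] using h

/-- **Kinetic marginal.** Splitting off coordinate `i` of the kinetic weight:
`∫⁻ h(p_i) e^{-∑_j p_j²/(2T)} dp = (∫⁻ h(a) e^{-a²/(2T)} da) · ∫⁻ e^{-∑_{j ≠ i} p_j²/(2T)}`. [folklore] -/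
theorem lintegral_coord_mul_kinetic (n : ℕ) (i : Fin (n + 1)) (T : ℝ) {h : ℝ → ℝ≥0∞}
    (hh : Measurable h) :
    ∫⁻ p : Fin (n + 1) → ℝ, h (p i) * ENNReal.ofReal (Real.exp (-(∑ j, p j ^ 2 / 2) / T)) =
      (∫⁻ a, h a * ENNReal.ofReal (Real.exp (-(a ^ 2 / 2) / T))) *
        ∫⁻ p : Fin n → ℝ, ENNReal.ofReal (Real.exp (-(∑ j, p j ^ 2 / 2) / T)) := by
  have hmp := (volume_preserving_piFinSuccAbove (fun _ : Fin (n + 1) => ℝ) i).symm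
  have hF : Measurable fun p : Fin (n + 1) → ℝ =>
      h (p i) * ENNReal.ofReal (Real.exp (-(∑ j, p j ^ 2 / 2) / T)) :=
    (hh.comp (measurable_pi_apply i)).mul (by fun_prop)
  have hKc : Continuous fun p : Fin n → ℝ => Real.exp (-(∑ j, p j ^ 2 / 2) / T) := by fun_prop
  rw [← hmp.lintegral_comp_emb (MeasurableEquiv.measurableEmbedding _), Measure.volume_eq_prod,
    ← lintegral_prod_mul (by fun_prop) hKc.measurable.ennreal_ofReal.aemeasurable]
  refine lintegral_congr fun y => ?_
  simp only [MeasurableEquiv.piFinSuccAbove_symm_apply, Fin.insertNthEquiv, Equiv.coe_fn_mk,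
    i.insertNth_apply_same]
  rw [Fin.sum_univ_succAbove _ i, i.insertNth_apply_same]
  simp only [i.insertNth_apply_succAbove]
  rw [mul_assoc, ← ENNReal.ofReal_mul (Real.exp_pos _).le, ← Real.exp_add]
  congr 3
  ring

/-- **Kinetic Chebyshev identity** at coordinate `i` (`K = ∑ p_j²/2`):
`(∫⁻ h(p_i) e^{-K/T} dp)(∫⁻ e^{-a²/(2T)} da) = (∫⁻ h e^{-a²/(2T)})(∫⁻ e^{-K/T} dp)`. [folklore] -/
theorem lintegral_coord_mul_kinetic_mul (n : ℕ) (i : Fin (n + 1)) (T : ℝ) {h : ℝ → ℝ≥0∞}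
    (hh : Measurable h) :
    (∫⁻ p : Fin (n + 1) → ℝ, h (p i) * ENNReal.ofReal (Real.exp (-(∑ j, p j ^ 2 / 2) / T))) *
        ∫⁻ a, ENNReal.ofReal (Real.exp (-(a ^ 2 / 2) / T)) =
      (∫⁻ a, h a * ENNReal.ofReal (Real.exp (-(a ^ 2 / 2) / T))) *
        ∫⁻ p : Fin (n + 1) → ℝ, ENNReal.ofReal (Real.exp (-(∑ j, p j ^ 2 / 2) / T)) := by
  have h1 := lintegral_coord_mul_kinetic n i T hh
  have h0 := lintegral_coord_mul_kinetic n i T (h := fun _ => 1) measurable_const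
  simp only [one_mul] at h0
  rw [h1, h0]
  ring

/-! ## The weighted-Lebesgue inequality for the majorant -/

/-- **Configurational side** at two sites `k, k'` of an `(m+1)`-chain. With `w = e^{-Φ/T}`,
`B = ∫ e^{-U/T}`, `A = ∫ a¹² e^{-U/T}`: `(∫⁻ (1 + q_k¹² + q_{k'}¹²) w dq) · B ≤ (B + 2A) · ∫⁻ w dq`
(the site-uniform Chebyshev step `ChainVariation.lintegral_coord_potential_le`). [folklore] -/
theorem pinnedChain_lintegral_conf_majorant_le (hω : 0 < ω₂) (hl : 0 ≤ lam) (hβ : 0 ≤ β) (γ : ℝ)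
    {T : ℝ} (hT : 0 < T) (m : ℕ) (k k' : Fin (m + 1)) :
    (∫⁻ q : Fin (m + 1) → ℝ, ENNReal.ofReal (1 + q k ^ 12 + q k' ^ 12) *
        ENNReal.ofReal (Real.exp (-(pinnedChain ω₂ lam β γ).potential (m + 1) q / T))) *
        ∫⁻ a, ENNReal.ofReal (Real.exp (-(pinnedChain ω₂ lam β γ).U a / T)) ≤
      ((∫⁻ a, ENNReal.ofReal (Real.exp (-(pinnedChain ω₂ lam β γ).U a / T))) +
        2 * ∫⁻ a, ENNReal.ofReal (a ^ 12) *
          ENNReal.ofReal (Real.exp (-(pinnedChain ω₂ lam β γ).U a / T))) *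
        ∫⁻ q : Fin (m + 1) → ℝ,
          ENNReal.ofReal (Real.exp (-(pinnedChain ω₂ lam β γ).potential (m + 1) q / T)) := by
  set P := pinnedChain ω₂ lam β γ with hP
  have hUc : Continuous P.U := (pinnedChain_contDiff_U ω₂ lam β γ (n := 0)).continuous
  have hVc : Continuous P.V := (pinnedChain_contDiff_V ω₂ lam β γ (n := 0)).continuous
  have hΦ : Measurable (P.potential (m + 1)) := (continuous_potential P hUc hVc _).measurable
  have hU := pinnedChain_U_radMono (β := β) hω.le hl γ
  have hV := pinnedChain_V_radMono hβ ω₂ lam γ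
  have hhm : Measurable fun a : ℝ => ENNReal.ofReal (a ^ 12) := by fun_prop
  have h0 := lintegral_coord_potential_le hUc hVc hU hV hT.le m k hhm
    (lightCone_radMono_ofReal_pow_even 6)
  have h1 := lintegral_coord_potential_le hUc hVc hU hV hT.le m k' hhm
    (lightCone_radMono_ofReal_pow_even 6)
  have e : ∀ q : Fin (m + 1) → ℝ, ENNReal.ofReal (1 + q k ^ 12 + q k' ^ 12) *
      ENNReal.ofReal (Real.exp (-P.potential (m + 1) q / T)) =
      (ENNReal.ofReal (Real.exp (-P.potential (m + 1) q / T)) +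
        ENNReal.ofReal (q k ^ 12) * ENNReal.ofReal (Real.exp (-P.potential (m + 1) q / T))) +
        ENNReal.ofReal (q k' ^ 12) * ENNReal.ofReal (Real.exp (-P.potential (m + 1) q / T)) := by
    intro q
    rw [ENNReal.ofReal_add (by positivity) (by positivity),
      ENNReal.ofReal_add zero_le_one (by positivity), ENNReal.ofReal_one]
    ring
  rw [lintegral_congr e, lintegral_add_left (by fun_prop), lintegral_add_left (by fun_prop)]
  set Y := ∫⁻ q : Fin (m + 1) → ℝ, ENNReal.ofReal (Real.exp (-P.potential (m + 1) q / T))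
  set X0 := ∫⁻ q : Fin (m + 1) → ℝ, ENNReal.ofReal (q k ^ 12) *
    ENNReal.ofReal (Real.exp (-P.potential (m + 1) q / T))
  set X1 := ∫⁻ q : Fin (m + 1) → ℝ, ENNReal.ofReal (q k' ^ 12) *
    ENNReal.ofReal (Real.exp (-P.potential (m + 1) q / T))
  set A := ∫⁻ a, ENNReal.ofReal (a ^ 12) * ENNReal.ofReal (Real.exp (-P.U a / T))
  set B := ∫⁻ a, ENNReal.ofReal (Real.exp (-P.U a / T))
  calc (Y + X0 + X1) * B = Y * B + X0 * B + X1 * B := by ring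
    _ ≤ Y * B + A * Y + A * Y := add_le_add (add_le_add le_rfl h0) h1
    _ = (B + 2 * A) * Y := by ring

/-- **Kinetic side** at two coordinates `k, k'`. With `κ = e^{-∑p²/(2T)}`, `m₀ = ∫ e^{-a²/(2T)}`,
`m₄ = ∫ a⁴ e^{-a²/(2T)}`: `(∫⁻ (p_k⁴ + p_{k'}⁴) κ dp) · m₀ = 2 m₄ · ∫⁻ κ dp`. [folklore] -/
theorem lintegral_kin_majorant_eq (n : ℕ) (k k' : Fin (n + 1)) (T : ℝ) :
    (∫⁻ p : Fin (n + 1) → ℝ, ENNReal.ofReal (p k ^ 4 + p k' ^ 4) *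
        ENNReal.ofReal (Real.exp (-(∑ j, p j ^ 2 / 2) / T))) *
        ∫⁻ a, ENNReal.ofReal (Real.exp (-(a ^ 2 / 2) / T)) =
      (2 * ∫⁻ a, ENNReal.ofReal (a ^ 4) * ENNReal.ofReal (Real.exp (-(a ^ 2 / 2) / T))) *
        ∫⁻ p : Fin (n + 1) → ℝ, ENNReal.ofReal (Real.exp (-(∑ j, p j ^ 2 / 2) / T)) := by
  have hhm : Measurable fun a : ℝ => ENNReal.ofReal (a ^ 4) := by fun_prop
  have h0 := lintegral_coord_mul_kinetic_mul n k T hhm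
  have h1 := lintegral_coord_mul_kinetic_mul n k' T hhm
  have e : ∀ p : Fin (n + 1) → ℝ, ENNReal.ofReal (p k ^ 4 + p k' ^ 4) *
      ENNReal.ofReal (Real.exp (-(∑ j, p j ^ 2 / 2) / T)) =
      ENNReal.ofReal (p k ^ 4) * ENNReal.ofReal (Real.exp (-(∑ j, p j ^ 2 / 2) / T)) +
        ENNReal.ofReal (p k' ^ 4) * ENNReal.ofReal (Real.exp (-(∑ j, p j ^ 2 / 2) / T)) := by
    intro p
    rw [ENNReal.ofReal_add (by positivity) (by positivity)]
    ring
  rw [lintegral_congr e, lintegral_add_left (by fun_prop), add_mul, h0, h1]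
  ring

/-- **The weighted-Lebesgue inequality for the majorant** `F = (p_k⁴ + p_{k'}⁴)(1 + q_k¹² + q_{k'}¹²)`:
`(∫⁻ F e^{-H/T}) · (B m₀) ≤ ((B + 2A) · 2m₄) · ∫⁻ e^{-H/T}`, constants independent of `N, k, k'`.
[folklore] -/
theorem pinnedChain_lintegral_majorant_mul_gibbsDensity_le :
    ∀ (ω₂ lam β γ : ℝ), 0 < ω₂ → 0 ≤ lam → 0 ≤ β → ∀ (T : ℝ), 0 < T →
    ∀ (m : ℕ) (k k' : Fin (m + 1)),
    (∫⁻ z : PhaseSpace (m + 1), ENNReal.ofReal ((z.2 k ^ 4 + z.2 k' ^ 4) *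
        (1 + z.1 k ^ 12 + z.1 k' ^ 12) * (pinnedChain ω₂ lam β γ).gibbsDensity (m + 1) T z)) *
        ((∫⁻ a, ENNReal.ofReal (Real.exp (-(pinnedChain ω₂ lam β γ).U a / T))) *
          ∫⁻ a, ENNReal.ofReal (Real.exp (-(a ^ 2 / 2) / T))) ≤
      (((∫⁻ a, ENNReal.ofReal (Real.exp (-(pinnedChain ω₂ lam β γ).U a / T))) +
          2 * ∫⁻ a, ENNReal.ofReal (a ^ 12) *
            ENNReal.ofReal (Real.exp (-(pinnedChain ω₂ lam β γ).U a / T))) *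
        (2 * ∫⁻ a, ENNReal.ofReal (a ^ 4) * ENNReal.ofReal (Real.exp (-(a ^ 2 / 2) / T)))) *
      ∫⁻ z : PhaseSpace (m + 1),
        ENNReal.ofReal ((pinnedChain ω₂ lam β γ).gibbsDensity (m + 1) T z) := by
  intro ω₂ lam β γ hω hl hβ T hT m k k'
  set P := pinnedChain ω₂ lam β γ with hP
  have hconf := pinnedChain_lintegral_conf_majorant_le hω hl hβ γ hT m k k'
  have hkin := lintegral_kin_majorant_eq m k k' T
  have hgm : Measurable fun q : Fin (m + 1) → ℝ => ENNReal.ofReal (1 + q k ^ 12 + q k' ^ 12) := by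
    fun_prop
  have hfm : Measurable fun p : Fin (m + 1) → ℝ => ENNReal.ofReal (p k ^ 4 + p k' ^ 4) := by
    fun_prop
  have hsep := pinnedChain_lintegral_sep_mul_gibbsDensity ω₂ lam β γ (m + 1) T hgm hfm
  have e : ∫⁻ z : PhaseSpace (m + 1), ENNReal.ofReal ((z.2 k ^ 4 + z.2 k' ^ 4) *
      (1 + z.1 k ^ 12 + z.1 k' ^ 12) * P.gibbsDensity (m + 1) T z) =
      ∫⁻ z : PhaseSpace (m + 1), ENNReal.ofReal (1 + z.1 k ^ 12 + z.1 k' ^ 12) *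
        ENNReal.ofReal (z.2 k ^ 4 + z.2 k' ^ 4) * ENNReal.ofReal (P.gibbsDensity (m + 1) T z) := by
    refine lintegral_congr fun z => ?_
    rw [ENNReal.ofReal_mul (by positivity), ENNReal.ofReal_mul (by positivity)]
    ring
  rw [e, hsep, pinnedChain_lintegral_gibbsDensity_eq]
  set G := ∫⁻ q : Fin (m + 1) → ℝ, ENNReal.ofReal (1 + q k ^ 12 + q k' ^ 12) *
    ENNReal.ofReal (Real.exp (-P.potential (m + 1) q / T))
  set Kf := ∫⁻ p : Fin (m + 1) → ℝ, ENNReal.ofReal (p k ^ 4 + p k' ^ 4) *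
    ENNReal.ofReal (Real.exp (-(∑ j, p j ^ 2 / 2) / T))
  set Y := ∫⁻ q : Fin (m + 1) → ℝ, ENNReal.ofReal (Real.exp (-P.potential (m + 1) q / T))
  set Y' := ∫⁻ p : Fin (m + 1) → ℝ, ENNReal.ofReal (Real.exp (-(∑ j, p j ^ 2 / 2) / T))
  set A := ∫⁻ a, ENNReal.ofReal (a ^ 12) * ENNReal.ofReal (Real.exp (-P.U a / T))
  set B := ∫⁻ a, ENNReal.ofReal (Real.exp (-P.U a / T))
  set m₀ := ∫⁻ a, ENNReal.ofReal (Real.exp (-(a ^ 2 / 2) / T))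
  set m₄ := ∫⁻ a, ENNReal.ofReal (a ^ 4) * ENNReal.ofReal (Real.exp (-(a ^ 2 / 2) / T))
  calc G * Kf * (B * m₀) = (G * B) * (Kf * m₀) := by ring
    _ ≤ ((B + 2 * A) * Y) * ((2 * m₄) * Y') := mul_le_mul' hconf hkin.le
    _ = (B + 2 * A) * (2 * m₄) * (Y * Y') := by ring

end Summit.AtomisticToContinuum.FouriersLaw.Theorems.NonBallistic

end
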